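import Summits.Ventures.HodgeRepro2.T5SU11ResolventGroundStateSharpness
import Summits.Ventures.HodgeRepro2.T5SU11ResolventNeumann

/-!
# The ground-state transform of the iterates on `L¹(Ξ sinh 2t dt)`, and the transformed Neumann series

Row 567 gives `∫ (G^I_λ g) Ξ sinh 2t = −(∫ g Ξ sinh 2s)/(λ − 1)²` for every source of the class in `L¹(Ξ sinh 2t dt)`, and
row 558 keeps such sources in `L¹(Ξ sinh 2t dt)` (row 503 keeps them in the class). Iterating,

* `iterate_transform_ground` — **`(G^I_λ)ⁿ g ∈ L¹(Ξ sinh 2t dt)` and `∫ ((G^I_λ)ⁿ g) Ξ sinh 2t = (−1)ⁿ (∫ g Ξ sinh 2s)/((λ − 1)²)ⁿ`**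
  for every `n`: the ground-state transform diagonalises every power of the resolvent with the eigenvalue `−1/(λ − 1)²`;
* `tsum_transform_neumann` — **the transformed Neumann series `Σ_k (μ − μ₂)^k (−1)^{k+1} T/((λ₂ − 1)²)^{k+1}` sums to
  `−T/(λ − 1)²` on the sharp disc `|μ − μ₂| < (λ₂ − 1)²`** (a geometric series: `(λ − 1)² = (λ₂ − 1)² + (μ − μ₂)`) — the
  transform of row 559's power series `Σ (μ − μ₂)^k (G^I_{λ₂})^{k+1} g = G^I_λ g` is consistent with row 567.

Nothing is claimed about (N).

Blind lane: Mathlib + the HodgeRepro2 prefix only; no sorry; axioms ⊆ {propext, Classical.choice,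
Quot.sound}.
-/

namespace Summit.Ventures.HodgeRepro2.T5SU11ResolventGroundStateTransformIterates

open Filter Topology MeasureTheory
open Set (Ioi Ioc)
open T5SU11Cartan T5SU11SphericalFunction T5SU11SphericalDecay T5SU11RadialGreenImproper T5SU11SphericalBounds
  T5SU11ResolventNeumann T5SU11ResolventL1GroundState T5SU11ResolventGroundStateSharpness

/-- **The transformed Neumann series is geometric**: for `|μ − μ₂| < (λ₂ − 1)²` and any `T`,
`Σ_k (μ − μ₂)^k (−1)^{k+1} T/((λ₂ − 1)²)^{k+1} = −T/(λ − 1)²` (`λ, λ₂ > 1`), since `(λ − 1)² = (λ₂ − 1)² + (μ − μ₂)`. -/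
theorem tsum_transform_neumann {lam lam₂ : ℝ} (hlam : 1 < lam) (hlam₂ : 1 < lam₂)
    (hq : |lam * (lam - 2) - lam₂ * (lam₂ - 2)| < (lam₂ - 1) ^ 2) (T : ℝ) :
    ∑' k : ℕ, (lam * (lam - 2) - lam₂ * (lam₂ - 2)) ^ k * ((-1 : ℝ) ^ (k + 1) * T / ((lam₂ - 1) ^ 2) ^ (k + 1))
      = -T / (lam - 1) ^ 2 := by
  have hp2 : 0 < (lam₂ - 1) ^ 2 := by
    have : 0 < lam₂ - 1 := by linarith
    positivity
  have hp2' : (lam₂ - 1) ^ 2 ≠ 0 := hp2.ne'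
  set κ := lam * (lam - 2) - lam₂ * (lam₂ - 2) with hκ
  set r := -κ / (lam₂ - 1) ^ 2 with hr
  have hr1 : |r| < 1 := by
    rw [hr, abs_div, abs_neg, abs_of_pos hp2, div_lt_one hp2]
    exact hq
  -- the terms are `(−T/(λ₂ − 1)²) · r^k`
  have e : ∀ k : ℕ, κ ^ k * ((-1 : ℝ) ^ (k + 1) * T / ((lam₂ - 1) ^ 2) ^ (k + 1))
      = (-T / (lam₂ - 1) ^ 2) * r ^ k := by
    intro k
    rw [hr, div_pow, neg_pow κ k, pow_succ (-1 : ℝ) k, pow_succ ((lam₂ - 1) ^ 2) k]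
    field_simp
  simp_rw [e]
  rw [tsum_mul_left, tsum_geometric_of_abs_lt_one hr1]
  -- `(λ − 1)² = (λ₂ − 1)² + κ`, so `(−T/(λ₂ − 1)²)/(1 − r) = −T/(λ − 1)²`
  have hden : (lam - 1) ^ 2 = (lam₂ - 1) ^ 2 + κ := by rw [hκ]; ring
  have hne : (lam - 1) ^ 2 ≠ 0 := by
    have : 0 < lam - 1 := by linarith
    positivity
  have h1r : 1 - r = (lam - 1) ^ 2 / (lam₂ - 1) ^ 2 := by
    rw [hr, hden, neg_div, sub_neg_eq_add, add_div, div_self hp2']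
  rw [h1r, inv_div, div_mul_div_comm, mul_comm (-T), mul_div_mul_left _ _ hp2']

section measure

variable [MeasurableSpace Circle] [BorelSpace Circle]

variable {lam : ℝ} (hlam : 1 < lam) {g : ℝ → ℝ} (hg : ContinuousOn g (Ioi 0))
  {M : ℝ} (hM : ∀ s ∈ Ioc (0 : ℝ) 1, |g s| ≤ M) (hM0 : 0 ≤ M)
  {ε C s₀ : ℝ} (hε : 2 - lam < ε) (hC : ∀ s, s₀ ≤ s → |g s| ≤ C * Real.exp (-ε * s))
  (hg1 : IntegrableOn (fun s => |g s| * sph 1 (hyp s) * Real.sinh (2 * s)) (Ioi 0))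

include hlam hg hM hM0 hε hC hg1 in
/-- **THE GROUND-STATE TRANSFORM OF THE ITERATES**: `(G^I_λ)ⁿ g ∈ L¹(Ξ sinh 2t dt)` and
`∫ ((G^I_λ)ⁿ g) Ξ sinh 2t = (−1)ⁿ (∫ g Ξ sinh 2s)/((λ − 1)²)ⁿ` for every `n`. -/
theorem iterate_transform_ground (n : ℕ) :
    IntegrableOn (fun s => |((greenSolI (fun t => sph lam (hyp t)) (sphDecay lam))^[n] g) s| * sph 1 (hyp s)
      * Real.sinh (2 * s)) (Ioi 0) ∧
    ∫ t in Ioi 0, ((greenSolI (fun t => sph lam (hyp t)) (sphDecay lam))^[n] g) t * sph 1 (hyp t) * Real.sinh (2 * t)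
      = (-1 : ℝ) ^ n * (∫ s in Ioi 0, g s * sph 1 (hyp s) * Real.sinh (2 * s)) / ((lam - 1) ^ 2) ^ n := by
  induction n with
  | zero => exact ⟨by simpa using hg1, by simp⟩
  | succ n ih =>
    obtain ⟨ih1, ih2⟩ := ih
    -- the class data of the `n`-th iterate at a rate `ε′ ∈ (2 − λ, min(ε, λ))`
    have hmin : 2 - lam < min ε lam := lt_min hε (by linarith)
    obtain ⟨hcont, ⟨M', hM'0, hM'⟩, hdec⟩ := iterate_class (lam₂ := lam) hlam hg hM hM0 hε hC n
    obtain ⟨K, T, _, _, hKT⟩ := hdec ((2 - lam + min ε lam) / 2) (by linarith)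
    have hε' : 2 - lam < (2 - lam + min ε lam) / 2 := by linarith
    rw [Function.iterate_succ_apply']
    refine ⟨?_, ?_⟩
    · -- `L¹(Ξ sinh)` membership of the next iterate (row 558)
      have h : IntegrableOn (fun s => |greenSolI (fun t => sph lam (hyp t)) (sphDecay lam)
          ((greenSolI (fun t => sph lam (hyp t)) (sphDecay lam))^[n] g) s * sph 1 (hyp s) * Real.sinh (2 * s)|)
          (Ioi 0) :=
        (integrableOn_greenSolI_mul_sph_one_mul_sinh hlam hcont hM' hM'0 hε' hKT ih1).abs
      refine h.congr_fun (fun s hs => ?_) measurableSet_Ioi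
      have hs0 : 0 < s := hs
      simp only
      rw [abs_mul, abs_mul, abs_of_pos (sph_hyp_pos 1 s),
        abs_of_nonneg (Real.sinh_nonneg_iff.mpr (by linarith : (0 : ℝ) ≤ 2 * s))]
    · -- the transform (row 567) on the `n`-th iterate, then the induction hypothesis
      rw [transform_greenSolI_one_of_integrable hlam hcont hM' hM'0 hε' hKT ih1, ih2, pow_succ (-1 : ℝ) n,
        pow_succ ((lam - 1) ^ 2) n]
      have hp : (lam - 1) ^ 2 ≠ 0 := by
        have : 0 < lam - 1 := by linarith
        positivity
      field_simp

end measure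

end Summit.Ventures.HodgeRepro2.T5SU11ResolventGroundStateTransformIterates
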